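import Summits.QuantumFields.BalabanUV.Beta.GAN24.OneStepConstraintLettersReg
import Summits.QuantumFields.BalabanUV.Beta.GAN24.FluctuationCovarianceLocalisation

/-!
# `BalabanUV.Beta.GAN24.OneStepConstraintLocalisation` — binder row G-an2-4 ∕ (CONV-C), routes C-R6° («VALUES») × R7 («TWO CURRENCIES»), PART 170:
# S2′(h) FOR BAŁABAN's ONE-STEP CONSTRAINT `Q = re QB N R M` — THE SOFT LETTER AND THE THREE ENDs.  For EVERY symmetric fine form `H` with `0 ≤ ⟨u,Hu⟩ ≤ h|u|²`,
# coercive on the fluctuation fields `ker (re QB)` (`γ₀`) and with entries decaying in the block distance (`|H(x,x′)| ≤ h₀e^{−δ_H·tdist(par x, par x′)}`), and every `a > 0`: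
# the regularised resolvent `K⁻¹ = (H + (re QB)ᵀ(a•1)(re QB))⁻¹` decays like `(2∕γ_K)e^{−r_F·tdist(par x, par x′)}`, and the EFFECTIVE FORM `𝒮 = effForm H (re QB)`, the HARD
# MINIMISER `ℋ = minOp H (re QB)` and the FLUCTUATION COVARIANCE `𝒢 = flucCov H (re QB)` decay exponentially in the coarse ∕ fine-to-coarse ∕ block torus distance, with constants
# that are CLOSED EXPRESSIONS in `(d, R, a, h, γ₀, h₀, δ_H)` and a volume-uniform lattice-sum profile `Kf` — PARTs 105 ∕ 106 with EVERY constraint-side letter discharged by PARTs 168 ∕ 169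
# (unit b2b-balaban-gan24-p3, gen 58; v1)

NOT IN PRINT; OUR PROOF ([folklore] composition BY NAME: PART 105 `EffectiveFormLocalisation` (`abs_effForm_le`, `abs_minOp_le`, `abs_blockProp_le_of_resolvent`, `abs_inv_mul_transpose_le_of_resolvent`,
`transpose_reg`), PART 106 `FluctuationCovarianceLocalisation.abs_flucCov_le`, t4-ne9-formalise-leaf-04's `FP.WellConditionedInverseLocality.abs_inv_le_of_coercive_localised` (the finite
Combes–Thomas ∕ [B4] Sect. 5 step, `B4Sect5Torus.rate`), PART 168 (`sum_abs_reM_QB_row`, `ub_QB`, `sum_eq_sum_par_off`), PART 169 (`coercive_reg_QB`, `reg_apply_eq_zero`, `abs_reg_apply_le`,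
`tdist_le_tdist_par_add_two`, `tdist_par_le_tdist_par_add_one`), and `Beta.VectorTailsCov.tdist` (its volume-uniform summability `sum_exp_tdist_le` is the intended source of `Kf`).
[Balaban1984PropagatorsI] (1.11) p. 19, (1.18) p. 20 LOCATE the averaging; [B9] Thm 3.1 (3.42)–(3.47) is the printed CLASS of statement; nothing printed is a hypothesis.)
HONEST FRAMING (cell contract, verbatim): «discharging `BetaPertH` makes Bałaban's UV stability UNCONDITIONAL — a real constructive-QFT result; it is NOT the continuum limit
and NOT the Clay problem.»  HONEST DEPENDENCY (verbatim): «continuum YM on T⁴ ⇐ BetaPertH ∧ nine spine estimates (0/9 proved); BetaPertH ⇐ (D1) ∧ (D4) ∧ CAP+tail; G-an2-4 gates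
asym, D1 and NE2/3/4.»

WHY (census V195, gen 57: «the fluctuation-covariance letter `𝒢 = flucCov(Σ_k, Q̃)` in the INPUT-triple currency … an adapter over PART 106 ∕ 114 + 127 ∕ 137 ∕ 144 ∕ 156 once V197 is chosen»).
THIS FILE is that adapter's CONSTRAINT HALF, for Bałaban's one-step averaging under either option of V197 (`QBlev L M k = QB (lev L k) L M` by `rfl`; option (i)'s `QB 1 L (cubic s′)` is
`N = 1`): after it, the DECAY half of the one-loop letter `𝒢` (and of `𝒮`, `ℋ`) needs ONLY the model-side inputs on the fine form `H` — symmetry, `0 ≤ ⟨u,Hu⟩ ≤ h|u|²`, a coercivity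
`γ₀` on `ker (re QB)`, and the entry decay `h₀e^{−δ_H·D}` (for the lineage's `H = re Σ_k` read on the block lattice: PART 118's `‖c_k⁻¹‖ ≤ B`, a (1.67)-type bound, PART 142's decay) —
plus a profile `Kf` for the coarse torus sums (`Σ_{y′} e^{−s·tdist(y,y′)} ≤ Kf(s)`, every `s > 0`; `VectorTailsCov.sum_exp_tdist_le` gives one uniformly in the volume for `d ≥ 2`).

THE GAUGES (no `def`; all `VectorTailsCov.tdist`, cast to `ℝ`): coarse `ρ(b,b′) = tdist(b.1, b′.1)`; fine `D(x,x′) = tdist(par x.1, par x′.1)` (block distance); fine-to-coarse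
`σ(x,b) = tdist(par x.1, b.1)`.  THE CONSTANTS (displayed as equations; instantiate with `rfl`): `γ_K⁻¹ = max (4∕γ₀) ((4h·R^{2d}∕γ₀ + 2R^{2d})∕a)` (PART 169), `c_K = h₀ + a·R^{−d}R^{−d}·e^{2δ_H}`,
`r_F = rate (s ↦ d·R^d·Kf s) γ_K c_K δ_H`, `c₀ = (2∕γ_K)e^{2r_F}`, `c₁ = (2∕γ_K)e^{r_F}`, `Λ = h·R^{2d}` (PART 168), `r_U = rate (s ↦ d·Kf s) (Λ+a)⁻¹ c₀ r_F`, `m = min r_F r_U`.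
WHAT THIS FILE PROVES (0 sorry, 0 `def`; `N, R ≥ 1`, every torus `M`, every `d`):
* §1 torus bookkeeping: `isPseudoDist_coarse`, `isPseudoDist_fine`, `sumBound_coarse` (profile `d·Kf`), `sum_exp_sigma_le` (PART 106's `Kσ = d·Kf`), `sumBound_fine` (profile `d·R^d·Kf`).
* §2 the soft letter: `abs_regForm_apply_le` (`|K(x,x′)| ≤ c_K·e^{−δ_H·D}`), **`abs_inv_regForm_le`** (`|K⁻¹(x,x′)| ≤ (2∕γ_K)·e^{−r_F·D(x,x′)}`), **`abs_blockProp_le_QB`**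
  (`|(QK⁻¹Qᵀ)(b,b′)| ≤ c₀e^{−r_F·ρ}`), **`abs_inv_mul_transpose_le_QB`** (`|(K⁻¹Qᵀ)(x,b)| ≤ c₁e^{−r_F·σ}`).
* §3 the ENDs: **`abs_effForm_le_QB`** (`|𝒮(b,b′)| ≤ (2(Λ+a)+a)·e^{−r_U·ρ(b,b′)}`), **`abs_minOp_le_QB`** (`|ℋ(x,b)| ≤ 2(Λ+a)·c₁·(d·Kf(m∕2))·e^{−(m∕2)σ(x,b)}`),
  **`abs_flucCov_le_QB`** (`|𝒢(x,x′)| ≤ (2∕γ_K + 2(Λ+a)c₁²(d·Kf(m∕2))(d·Kf(m∕4)))·e^{−min r_F (m∕4)·D(x,x′)}`).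
WHAT IT IS NOT: no model-side input is discharged (which `H`, i.e. «which Gaussian is the k-th step», is row an1's ∕ the OWNER's dictionary — census V197); ONE block step (coarse = the
image lattice of `QB N R M`), so «k-uniform» here means: the constants see neither `N` nor `M`; the RATE half of (CONV-C) is untouched (PART 114 is its transfer).  SUPPLIER work; no
consumer of record yet; NEVER «G-an2-4 closed»; NOT (CONV-C), NOT D1, NOT `BetaPertH`, NOT continuum, NOT Clay.  Records: `HOME/b2b-balaban-gan24-p3/gen58/README.md`.
-/

noncomputable section

open scoped BigOperators Matrix
open Finset Matrix

namespace Summit.QuantumFields.BalabanUV.Beta.GAN24.OneStepConstraintLocalisation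

open Literature.MathematicalPhysics.QuantumFieldTheory.Balaban1983to89
open Literature.MathematicalPhysics.QuantumFieldTheory.Balaban1983to89.B4Sect5Torus (IsPseudoDist SumBound rate rate_pos)
open Literature.MathematicalPhysics.QuantumFieldTheory.Balaban1983to89.Beta.Composition (blockProp)
open Literature.MathematicalPhysics.QuantumFieldTheory.Balaban1983to89.Beta.CompositionSingular (effForm minOp flucCov)
open Literature.MathematicalPhysics.QuantumFieldTheory.Balaban1983to89.B5Prop11Plancherel (Tor fine)
open Literature.MathematicalPhysics.QuantumFieldTheory.Balaban1983to89.B5RealFields (reM)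
open Literature.MathematicalPhysics.QuantumFieldTheory.Balaban1983to89.Beta.VectorTailsCov (tdist tdist_self tdist_triangle tdist_comm)
open Summit.QuantumFields.BalabanUV.T4Continuum.BalabanLineAverage (QB)
open Summit.QuantumFields.BalabanUV.T4Continuum.BalabanAveragedTowerModes (par par_cpt_add_off)
open Summit.QuantumFields.BalabanUV.Beta.FP.WellConditionedInverseLocality (abs_inv_le_of_coercive_localised)
open Summit.QuantumFields.BalabanUV.Beta.GAN24.EffectiveFormLocalisation (transpose_reg abs_effForm_le abs_minOp_le abs_blockProp_le_of_resolvent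
  abs_inv_mul_transpose_le_of_resolvent)
open Summit.QuantumFields.BalabanUV.Beta.GAN24.FluctuationCovarianceLocalisation (abs_flucCov_le)
open Summit.QuantumFields.BalabanUV.Beta.GAN24.OneStepConstraintLetters (sum_abs_reM_QB_row ub_QB sum_eq_sum_par_off)
open Summit.QuantumFields.BalabanUV.Beta.GAN24.OneStepConstraintLettersReg (coercive_reg_QB reg_apply_eq_zero abs_reg_apply_le tdist_le_tdist_par_add_two
  tdist_par_le_tdist_par_add_one)

variable {d : ℕ} (N R : ℕ) [NeZero N] [NeZero R] (M : Fin d → ℕ) [hM : ∀ μ, NeZero (M μ)]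

/-! ## §1 Torus bookkeeping: the three gauges and their lattice sums -/

section Gauges

/-- the coarse gauge `ρ(b,b′) = tdist(b.1,b′.1)` is a pseudo-distance (`B4Sect5Torus.IsPseudoDist`). [folklore] -/
theorem isPseudoDist_coarse : IsPseudoDist (fun b b' : Tor (fine N M) × Fin d => (tdist b.1 b'.1 : ℝ)) :=
  ⟨fun _ _ => by rw [tdist_comm], fun _ => by rw [tdist_self, Nat.cast_zero], fun _ _ _ => by exact_mod_cast tdist_triangle _ _ _⟩

omit [NeZero R] in
/-- the fine gauge `D(x,x′) = tdist(par x.1, par x′.1)` (block distance) is a pseudo-distance. [folklore] -/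
theorem isPseudoDist_fine : IsPseudoDist (fun x x' : Tor (fine (R * N) M) × Fin d => (tdist (par N R M x.1) (par N R M x'.1) : ℝ)) :=
  (isPseudoDist_coarse (d := d) N M).comp fun x : Tor (fine (R * N) M) × Fin d => (par N R M x.1, x.2)

variable {Kf : ℝ → ℝ}

/-- **coarse lattice sums**: `Σ_{(y′,μ′)} e^{−s·tdist(y,y′)} ≤ d·Kf(s)` from the site profile `Σ_{y′} e^{−s·tdist(y,y′)} ≤ Kf(s)` (PART 105's `SumBound ρ (d·Kf)`). [folklore] -/
theorem sumBound_coarse (hKf : ∀ s : ℝ, 0 < s → ∀ y : Tor (fine N M), ∑ y' : Tor (fine N M), Real.exp (-(s * (tdist y y' : ℝ))) ≤ Kf s) :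
    SumBound (fun b b' : Tor (fine N M) × Fin d => (tdist b.1 b'.1 : ℝ)) (fun s => (d : ℝ) * Kf s) := by
  intro s hs b
  rw [Fintype.sum_prod_type]
  simp only [Finset.sum_const, Finset.card_univ, Fintype.card_fin, nsmul_eq_mul]
  rw [← Finset.mul_sum]
  exact mul_le_mul_of_nonneg_left (hKf s hs b.1) (Nat.cast_nonneg d)

omit [NeZero R] in
/-- **the fine-to-coarse gauge sums** (PART 106's `Kσ = d·Kf`): `Σ_b e^{−s·tdist(par x.1, b.1)} ≤ d·Kf(s)`. [folklore] -/
theorem sum_exp_sigma_le (hKf : ∀ s : ℝ, 0 < s → ∀ y : Tor (fine N M), ∑ y' : Tor (fine N M), Real.exp (-(s * (tdist y y' : ℝ))) ≤ Kf s)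
    {s : ℝ} (hs : 0 < s) (x : Tor (fine (R * N) M) × Fin d) :
    ∑ b : Tor (fine N M) × Fin d, Real.exp (-(s * (tdist (par N R M x.1) b.1 : ℝ))) ≤ (d : ℝ) * Kf s :=
  sumBound_coarse N M hKf s hs (par N R M x.1, x.2)

/-- **fine lattice sums against the block distance**: `Σ_{x′} e^{−s·tdist(par x, par x′)} ≤ d·R^d·Kf(s)` (each block carries `R^d` sites per component). [folklore] -/
theorem sumBound_fine (hKf : ∀ s : ℝ, 0 < s → ∀ y : Tor (fine N M), ∑ y' : Tor (fine N M), Real.exp (-(s * (tdist y y' : ℝ))) ≤ Kf s) :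
    SumBound (fun x x' : Tor (fine (R * N) M) × Fin d => (tdist (par N R M x.1) (par N R M x'.1) : ℝ)) (fun s => (d : ℝ) * (R : ℝ) ^ d * Kf s) := by
  intro s hs x
  rw [Fintype.sum_prod_type]
  simp only [Finset.sum_const, Finset.card_univ, Fintype.card_fin, nsmul_eq_mul]
  rw [sum_eq_sum_par_off N R M (fun w : Tor (fine (R * N) M) => (d : ℝ) * Real.exp (-(s * (tdist (par N R M x.1) (par N R M w) : ℝ))))]
  simp only [par_cpt_add_off, Finset.sum_const, Finset.card_univ, Fintype.card_fun, Fintype.card_fin, nsmul_eq_mul, Nat.cast_pow]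
  rw [← Finset.mul_sum, ← Finset.mul_sum]
  have hRd : (0 : ℝ) ≤ (R : ℝ) ^ d := pow_nonneg (Nat.cast_nonneg R) d
  calc (R : ℝ) ^ d * ((d : ℝ) * ∑ y : Tor (fine N M), Real.exp (-(s * (tdist (par N R M x.1) y : ℝ))))
      ≤ (R : ℝ) ^ d * ((d : ℝ) * Kf s) := mul_le_mul_of_nonneg_left (mul_le_mul_of_nonneg_left (hKf s hs _) (Nat.cast_nonneg d)) hRd
    _ = (d : ℝ) * (R : ℝ) ^ d * Kf s := by ring

end Gauges

/-! ## §2 The soft letter for `K = H + (re QB)ᵀ(a•1)(re QB)` and PART 105 §4's two unit letters -/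

section Soft

variable {H : Matrix (Tor (fine (R * N) M) × Fin d) (Tor (fine (R * N) M) × Fin d) ℝ} {Kf : ℝ → ℝ}

/-- **THE REGULARISED FORM IS LOCALISED**: `|K(x,x′)| ≤ (h₀ + a·R^{−d}R^{−d}·e^{2δ_H})·e^{−δ_H·tdist(par x, par x′)}` (the regulariser vanishes beyond block distance `2`, PART 169). [folklore] -/
theorem abs_regForm_apply_le {a h₀ δH : ℝ} (ha : 0 ≤ a) (hδH : 0 ≤ δH)
    (hHent : ∀ x x', |H x x'| ≤ h₀ * Real.exp (-(δH * (tdist (par N R M x.1) (par N R M x'.1) : ℝ)))) (x x' : Tor (fine (R * N) M) × Fin d) :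
    |(H + (reM (QB N R M))ᵀ * (a • (1 : Matrix (Tor (fine N M) × Fin d) (Tor (fine N M) × Fin d) ℝ)) * reM (QB N R M)) x x'| ≤
      (h₀ + a * (((R : ℝ) ^ d)⁻¹ * ((R : ℝ) ^ d)⁻¹) * Real.exp (2 * δH)) * Real.exp (-(δH * (tdist (par N R M x.1) (par N R M x'.1) : ℝ))) := by
  rw [Matrix.add_apply, add_mul]
  refine (abs_add_le _ _).trans (add_le_add (hHent x x') ?_)
  by_cases hD : x.2 = x'.2 ∧ tdist (par N R M x.1) (par N R M x'.1) ≤ 2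
  · have h1 := abs_reg_apply_le N R M a x x'
    rw [abs_of_nonneg ha] at h1
    have hD2 : (tdist (par N R M x.1) (par N R M x'.1) : ℝ) ≤ 2 := by exact_mod_cast hD.2
    have hexp : 1 ≤ Real.exp (2 * δH) * Real.exp (-(δH * (tdist (par N R M x.1) (par N R M x'.1) : ℝ))) := by
      rw [← Real.exp_add]
      exact Real.one_le_exp (by nlinarith)
    calc |((reM (QB N R M))ᵀ * (a • (1 : Matrix (Tor (fine N M) × Fin d) (Tor (fine N M) × Fin d) ℝ)) * reM (QB N R M)) x x'|
        ≤ a * (((R : ℝ) ^ d)⁻¹ * ((R : ℝ) ^ d)⁻¹) * 1 := by rw [mul_one]; exact h1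
      _ ≤ a * (((R : ℝ) ^ d)⁻¹ * ((R : ℝ) ^ d)⁻¹) * (Real.exp (2 * δH) * Real.exp (-(δH * (tdist (par N R M x.1) (par N R M x'.1) : ℝ)))) :=
          mul_le_mul_of_nonneg_left hexp (by positivity)
      _ = _ := by ring
  · rw [reg_apply_eq_zero N R M a hD, abs_zero]
    positivity

omit [NeZero R] in
/-- `γ_K > 0`. [folklore] -/
theorem gammaK_pos {h γ₀ a : ℝ} (hγ₀ : 0 < γ₀) :
    0 < (max (4 / γ₀) ((4 * h * ((R : ℝ) ^ d) ^ 2 / γ₀ + 2 * ((R : ℝ) ^ d) ^ 2) / a))⁻¹ :=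
  inv_pos.mpr (lt_of_lt_of_le (div_pos four_pos hγ₀) (le_max_left _ _))

/-- **`abs_inv_regForm_le` — THE SOFT LETTER FOR BAŁABAN's ONE-STEP CONSTRAINT** [our proof; finite Combes–Thomas `abs_inv_le_of_coercive_localised` with PART 169's coercivity
`coercive_reg_QB` and `abs_regForm_apply_le`, on the fine gauge with profile `d·R^d·Kf`]: `|K⁻¹(x,x′)| ≤ (2∕γ_K)·e^{−r_F·tdist(par x, par x′)}`. -/
theorem abs_inv_regForm_le (hKf0 : ∀ s : ℝ, 0 < s → 0 ≤ Kf s)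
    (hKf : ∀ s : ℝ, 0 < s → ∀ y : Tor (fine N M), ∑ y' : Tor (fine N M), Real.exp (-(s * (tdist y y' : ℝ))) ≤ Kf s)
    (hH : Hᵀ = H) (hpsd : ∀ z, 0 ≤ z ⬝ᵥ (H *ᵥ z)) {h : ℝ} (hh : 0 ≤ h) (hHub : ∀ u, u ⬝ᵥ (H *ᵥ u) ≤ h * (u ⬝ᵥ u)) {γ₀ : ℝ} (hγ₀ : 0 < γ₀)
    (hker : ∀ z, reM (QB N R M) *ᵥ z = 0 → γ₀ * (z ⬝ᵥ z) ≤ z ⬝ᵥ (H *ᵥ z)) {a h₀ δH : ℝ} (ha : 0 < a) (hh₀ : 0 ≤ h₀) (hδH : 0 < δH)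
    (hHent : ∀ x x', |H x x'| ≤ h₀ * Real.exp (-(δH * (tdist (par N R M x.1) (par N R M x'.1) : ℝ))))
    {γK cK rF : ℝ} (hγK : γK = (max (4 / γ₀) ((4 * h * ((R : ℝ) ^ d) ^ 2 / γ₀ + 2 * ((R : ℝ) ^ d) ^ 2) / a))⁻¹)
    (hcK : cK = h₀ + a * (((R : ℝ) ^ d)⁻¹ * ((R : ℝ) ^ d)⁻¹) * Real.exp (2 * δH)) (hrF : rF = rate (fun s => (d : ℝ) * (R : ℝ) ^ d * Kf s) γK cK δH)
    (x x' : Tor (fine (R * N) M) × Fin d) :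
    |(H + (reM (QB N R M))ᵀ * (a • (1 : Matrix (Tor (fine N M) × Fin d) (Tor (fine N M) × Fin d) ℝ)) * reM (QB N R M))⁻¹ x x'| ≤
      2 / γK * Real.exp (-(rF * (tdist (par N R M x.1) (par N R M x'.1) : ℝ))) := by
  have hγpos : 0 < γK := by rw [hγK]; exact gammaK_pos R hγ₀
  have hcK0 : 0 ≤ cK := by rw [hcK]; positivity
  have hprof : ∀ s : ℝ, 0 < s → 0 ≤ (d : ℝ) * (R : ℝ) ^ d * Kf s := fun s hs => by have := hKf0 s hs; positivity
  have hK := coercive_reg_QB N R M hH hpsd hh hHub hγ₀ hker ha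
  rw [← hγK] at hK
  have h := abs_inv_le_of_coercive_localised hprof (isPseudoDist_fine N R M) (sumBound_fine N R M hKf) (transpose_reg hH a) hγpos hcK0 hδH hK
    (fun p q => by rw [hcK]; exact abs_regForm_apply_le N R M ha.le hδH.le hHent p q) x x'
  rwa [← hrF] at h

/-- **`abs_blockProp_le_QB` — THE UNIT-LATTICE BLOCK PROPAGATOR `P = (re QB)K⁻¹(re QB)ᵀ` IS LOCALISED**: `|P(b,b′)| ≤ (2∕γ_K)e^{2r_F}·e^{−r_F·tdist(b,b′)}` (PART 105 §4 with
`q₁ = 1`, `R = 2` from PARTs 168 ∕ 169). [folklore] -/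
theorem abs_blockProp_le_QB (hKf0 : ∀ s : ℝ, 0 < s → 0 ≤ Kf s)
    (hKf : ∀ s : ℝ, 0 < s → ∀ y : Tor (fine N M), ∑ y' : Tor (fine N M), Real.exp (-(s * (tdist y y' : ℝ))) ≤ Kf s)
    (hH : Hᵀ = H) (hpsd : ∀ z, 0 ≤ z ⬝ᵥ (H *ᵥ z)) {h : ℝ} (hh : 0 ≤ h) (hHub : ∀ u, u ⬝ᵥ (H *ᵥ u) ≤ h * (u ⬝ᵥ u)) {γ₀ : ℝ} (hγ₀ : 0 < γ₀)
    (hker : ∀ z, reM (QB N R M) *ᵥ z = 0 → γ₀ * (z ⬝ᵥ z) ≤ z ⬝ᵥ (H *ᵥ z)) {a h₀ δH : ℝ} (ha : 0 < a) (hh₀ : 0 ≤ h₀) (hδH : 0 < δH)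
    (hHent : ∀ x x', |H x x'| ≤ h₀ * Real.exp (-(δH * (tdist (par N R M x.1) (par N R M x'.1) : ℝ))))
    {γK cK rF c₀ : ℝ} (hγK : γK = (max (4 / γ₀) ((4 * h * ((R : ℝ) ^ d) ^ 2 / γ₀ + 2 * ((R : ℝ) ^ d) ^ 2) / a))⁻¹)
    (hcK : cK = h₀ + a * (((R : ℝ) ^ d)⁻¹ * ((R : ℝ) ^ d)⁻¹) * Real.exp (2 * δH)) (hrF : rF = rate (fun s => (d : ℝ) * (R : ℝ) ^ d * Kf s) γK cK δH)
    (hc₀ : c₀ = 2 / γK * Real.exp (2 * rF)) (b b' : Tor (fine N M) × Fin d) :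
    |blockProp (H + (reM (QB N R M))ᵀ * (a • (1 : Matrix (Tor (fine N M) × Fin d) (Tor (fine N M) × Fin d) ℝ)) * reM (QB N R M)) (reM (QB N R M)) b b'| ≤
      c₀ * Real.exp (-(rF * (tdist b.1 b'.1 : ℝ))) := by
  have hγpos : 0 < γK := by rw [hγK]; exact gammaK_pos R hγ₀
  have hcK0 : 0 ≤ cK := by rw [hcK]; positivity
  have hprof : ∀ s : ℝ, 0 < s → 0 ≤ (d : ℝ) * (R : ℝ) ^ d * Kf s := fun s hs => by have := hKf0 s hs; positivity
  have hrF0 : 0 < rF := by rw [hrF]; exact rate_pos hprof hγpos hcK0 hδH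
  have hG := abs_inv_regForm_le N R M hKf0 hKf hH hpsd hh hHub hγ₀ hker ha hh₀ hδH hHent hγK hcK hrF
  have h := abs_blockProp_le_of_resolvent (ρ := fun b b' : Tor (fine N M) × Fin d => (tdist b.1 b'.1 : ℝ))
    (D := fun x x' : Tor (fine (R * N) M) × Fin d => (tdist (par N R M x.1) (par N R M x'.1) : ℝ))
    (by positivity : (0 : ℝ) ≤ 2 / γK) hrF0.le hG (fun b => (sum_abs_reM_QB_row N R M b).le)
    (fun b x b' x' hb hb' => tdist_le_tdist_par_add_two N R M hb hb') b b'
  rw [hc₀]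
  calc _ ≤ (1 : ℝ) ^ 2 * (2 / γK) * Real.exp (rF * 2) * Real.exp (-(rF * (tdist b.1 b'.1 : ℝ))) := h
    _ = 2 / γK * Real.exp (2 * rF) * Real.exp (-(rF * (tdist b.1 b'.1 : ℝ))) := by rw [one_pow, one_mul, mul_comm rF 2]

/-- **`abs_inv_mul_transpose_le_QB` — THE SOFT COLUMNS `K⁻¹(re QB)ᵀ` ARE LOCALISED**: `|(K⁻¹(re QB)ᵀ)(x,b)| ≤ (2∕γ_K)e^{r_F}·e^{−r_F·tdist(par x, b)}` (PART 105 §4 with `q₁ = 1`,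
`R′ = 1`). [folklore] -/
theorem abs_inv_mul_transpose_le_QB (hKf0 : ∀ s : ℝ, 0 < s → 0 ≤ Kf s)
    (hKf : ∀ s : ℝ, 0 < s → ∀ y : Tor (fine N M), ∑ y' : Tor (fine N M), Real.exp (-(s * (tdist y y' : ℝ))) ≤ Kf s)
    (hH : Hᵀ = H) (hpsd : ∀ z, 0 ≤ z ⬝ᵥ (H *ᵥ z)) {h : ℝ} (hh : 0 ≤ h) (hHub : ∀ u, u ⬝ᵥ (H *ᵥ u) ≤ h * (u ⬝ᵥ u)) {γ₀ : ℝ} (hγ₀ : 0 < γ₀)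
    (hker : ∀ z, reM (QB N R M) *ᵥ z = 0 → γ₀ * (z ⬝ᵥ z) ≤ z ⬝ᵥ (H *ᵥ z)) {a h₀ δH : ℝ} (ha : 0 < a) (hh₀ : 0 ≤ h₀) (hδH : 0 < δH)
    (hHent : ∀ x x', |H x x'| ≤ h₀ * Real.exp (-(δH * (tdist (par N R M x.1) (par N R M x'.1) : ℝ))))
    {γK cK rF c₁ : ℝ} (hγK : γK = (max (4 / γ₀) ((4 * h * ((R : ℝ) ^ d) ^ 2 / γ₀ + 2 * ((R : ℝ) ^ d) ^ 2) / a))⁻¹)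
    (hcK : cK = h₀ + a * (((R : ℝ) ^ d)⁻¹ * ((R : ℝ) ^ d)⁻¹) * Real.exp (2 * δH)) (hrF : rF = rate (fun s => (d : ℝ) * (R : ℝ) ^ d * Kf s) γK cK δH)
    (hc₁ : c₁ = 2 / γK * Real.exp rF) (x : Tor (fine (R * N) M) × Fin d) (b : Tor (fine N M) × Fin d) :
    |((H + (reM (QB N R M))ᵀ * (a • (1 : Matrix (Tor (fine N M) × Fin d) (Tor (fine N M) × Fin d) ℝ)) * reM (QB N R M))⁻¹ * (reM (QB N R M))ᵀ) x b| ≤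
      c₁ * Real.exp (-(rF * (tdist (par N R M x.1) b.1 : ℝ))) := by
  have hγpos : 0 < γK := by rw [hγK]; exact gammaK_pos R hγ₀
  have hcK0 : 0 ≤ cK := by rw [hcK]; positivity
  have hprof : ∀ s : ℝ, 0 < s → 0 ≤ (d : ℝ) * (R : ℝ) ^ d * Kf s := fun s hs => by have := hKf0 s hs; positivity
  have hrF0 : 0 < rF := by rw [hrF]; exact rate_pos hprof hγpos hcK0 hδH
  have hG := abs_inv_regForm_le N R M hKf0 hKf hH hpsd hh hHub hγ₀ hker ha hh₀ hδH hHent hγK hcK hrF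
  have h := abs_inv_mul_transpose_le_of_resolvent (σ := fun (x : Tor (fine (R * N) M) × Fin d) (b : Tor (fine N M) × Fin d) => (tdist (par N R M x.1) b.1 : ℝ))
    (D := fun x x' : Tor (fine (R * N) M) × Fin d => (tdist (par N R M x.1) (par N R M x'.1) : ℝ))
    (by positivity : (0 : ℝ) ≤ 2 / γK) hrF0.le hG (fun b => (sum_abs_reM_QB_row N R M b).le)
    (fun b' x x' hb' => tdist_par_le_tdist_par_add_one N R M x hb') x b
  rw [hc₁]
  calc _ ≤ (1 : ℝ) * (2 / γK) * Real.exp (rF * 1) * Real.exp (-(rF * (tdist (par N R M x.1) b.1 : ℝ))) := h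
    _ = 2 / γK * Real.exp rF * Real.exp (-(rF * (tdist (par N R M x.1) b.1 : ℝ))) := by rw [one_mul, mul_one]

end Soft

/-! ## §3 The ENDs: effective form, hard minimiser, fluctuation covariance -/

section End

variable {H : Matrix (Tor (fine (R * N) M) × Fin d) (Tor (fine (R * N) M) × Fin d) ℝ} {Kf : ℝ → ℝ}

/-- **`abs_effForm_le_QB` — THE EFFECTIVE FORM OF BAŁABAN's ONE-STEP CONSTRAINT IS LOCALISED** [our proof; PART 105 `abs_effForm_le` with `hK` := PART 169 `coercive_reg_QB`, `hUB` := PART 168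
`ub_QB` (`Λ = h·R^{2d}`), `hP` := `abs_blockProp_le_QB`, the coarse profile `d·Kf`]: `|𝒮(b,b′)| ≤ (2(Λ+a)+a)·e^{−r_U·tdist(b,b′)}`. -/
theorem abs_effForm_le_QB (hKf0 : ∀ s : ℝ, 0 < s → 0 ≤ Kf s)
    (hKf : ∀ s : ℝ, 0 < s → ∀ y : Tor (fine N M), ∑ y' : Tor (fine N M), Real.exp (-(s * (tdist y y' : ℝ))) ≤ Kf s)
    (hH : Hᵀ = H) (hpsd : ∀ z, 0 ≤ z ⬝ᵥ (H *ᵥ z)) {h : ℝ} (hh : 0 ≤ h) (hHub : ∀ u, u ⬝ᵥ (H *ᵥ u) ≤ h * (u ⬝ᵥ u)) {γ₀ : ℝ} (hγ₀ : 0 < γ₀)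
    (hker : ∀ z, reM (QB N R M) *ᵥ z = 0 → γ₀ * (z ⬝ᵥ z) ≤ z ⬝ᵥ (H *ᵥ z)) {a h₀ δH : ℝ} (ha : 0 < a) (hh₀ : 0 ≤ h₀) (hδH : 0 < δH)
    (hHent : ∀ x x', |H x x'| ≤ h₀ * Real.exp (-(δH * (tdist (par N R M x.1) (par N R M x'.1) : ℝ))))
    {γK cK rF c₀ Λ rU : ℝ} (hγK : γK = (max (4 / γ₀) ((4 * h * ((R : ℝ) ^ d) ^ 2 / γ₀ + 2 * ((R : ℝ) ^ d) ^ 2) / a))⁻¹)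
    (hcK : cK = h₀ + a * (((R : ℝ) ^ d)⁻¹ * ((R : ℝ) ^ d)⁻¹) * Real.exp (2 * δH)) (hrF : rF = rate (fun s => (d : ℝ) * (R : ℝ) ^ d * Kf s) γK cK δH)
    (hc₀ : c₀ = 2 / γK * Real.exp (2 * rF)) (hΛ : Λ = h * ((R : ℝ) ^ d) ^ 2) (hrU : rU = rate (fun s => (d : ℝ) * Kf s) (Λ + a)⁻¹ c₀ rF)
    (b b' : Tor (fine N M) × Fin d) :
    |effForm H (reM (QB N R M)) b b'| ≤ (2 * (Λ + a) + a) * Real.exp (-(rU * (tdist b.1 b'.1 : ℝ))) := by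
  have hγpos : 0 < γK := by rw [hγK]; exact gammaK_pos R hγ₀
  have hcK0 : 0 ≤ cK := by rw [hcK]; positivity
  have hprofF : ∀ s : ℝ, 0 < s → 0 ≤ (d : ℝ) * (R : ℝ) ^ d * Kf s := fun s hs => by have := hKf0 s hs; positivity
  have hprofU : ∀ s : ℝ, 0 < s → 0 ≤ (d : ℝ) * Kf s := fun s hs => by have := hKf0 s hs; positivity
  have hrF0 : 0 < rF := by rw [hrF]; exact rate_pos hprofF hγpos hcK0 hδH
  have hc₀0 : 0 ≤ c₀ := by rw [hc₀]; positivity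
  have hΛ0 : 0 ≤ Λ := by rw [hΛ]; positivity
  have hK := coercive_reg_QB N R M hH hpsd hh hHub hγ₀ hker ha
  rw [← hγK] at hK
  have hUB := ub_QB N R M (H := H) hHub
  simp_rw [← hΛ] at hUB
  have hP := abs_blockProp_le_QB N R M hKf0 hKf hH hpsd hh hHub hγ₀ hker ha hh₀ hδH hHent hγK hcK hrF hc₀
  have h := abs_effForm_le hprofU (isPseudoDist_coarse N M) (sumBound_coarse N M hKf) hH hpsd ha hγpos hK hΛ0 hUB hc₀0 hrF0 hP b b'
  rwa [← hrU] at h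

/-- **`abs_minOp_le_QB` — THE HARD MINIMISER OF BAŁABAN's ONE-STEP CONSTRAINT HAS LOCALISED COLUMNS** [our proof; PART 105 `abs_minOp_le` with the same letters plus
`σ(x,b) = tdist(par x, b)`, its `ρ`-compatibility (torus triangle inequality) and `hKQ` := `abs_inv_mul_transpose_le_QB`]:
`|ℋ(x,b)| ≤ 2(Λ+a)·c₁·(d·Kf(m∕2))·e^{−(m∕2)·tdist(par x, b)}`, `m = min r_F r_U`. -/
theorem abs_minOp_le_QB (hKf0 : ∀ s : ℝ, 0 < s → 0 ≤ Kf s)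
    (hKf : ∀ s : ℝ, 0 < s → ∀ y : Tor (fine N M), ∑ y' : Tor (fine N M), Real.exp (-(s * (tdist y y' : ℝ))) ≤ Kf s)
    (hH : Hᵀ = H) (hpsd : ∀ z, 0 ≤ z ⬝ᵥ (H *ᵥ z)) {h : ℝ} (hh : 0 ≤ h) (hHub : ∀ u, u ⬝ᵥ (H *ᵥ u) ≤ h * (u ⬝ᵥ u)) {γ₀ : ℝ} (hγ₀ : 0 < γ₀)
    (hker : ∀ z, reM (QB N R M) *ᵥ z = 0 → γ₀ * (z ⬝ᵥ z) ≤ z ⬝ᵥ (H *ᵥ z)) {a h₀ δH : ℝ} (ha : 0 < a) (hh₀ : 0 ≤ h₀) (hδH : 0 < δH)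
    (hHent : ∀ x x', |H x x'| ≤ h₀ * Real.exp (-(δH * (tdist (par N R M x.1) (par N R M x'.1) : ℝ))))
    {γK cK rF c₀ c₁ Λ rU m : ℝ} (hγK : γK = (max (4 / γ₀) ((4 * h * ((R : ℝ) ^ d) ^ 2 / γ₀ + 2 * ((R : ℝ) ^ d) ^ 2) / a))⁻¹)
    (hcK : cK = h₀ + a * (((R : ℝ) ^ d)⁻¹ * ((R : ℝ) ^ d)⁻¹) * Real.exp (2 * δH)) (hrF : rF = rate (fun s => (d : ℝ) * (R : ℝ) ^ d * Kf s) γK cK δH)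
    (hc₀ : c₀ = 2 / γK * Real.exp (2 * rF)) (hc₁ : c₁ = 2 / γK * Real.exp rF) (hΛ : Λ = h * ((R : ℝ) ^ d) ^ 2)
    (hrU : rU = rate (fun s => (d : ℝ) * Kf s) (Λ + a)⁻¹ c₀ rF) (hm : m = min rF rU)
    (x : Tor (fine (R * N) M) × Fin d) (b : Tor (fine N M) × Fin d) :
    |minOp H (reM (QB N R M)) x b| ≤ 2 * (Λ + a) * c₁ * ((d : ℝ) * Kf (m / 2)) * Real.exp (-(m / 2 * (tdist (par N R M x.1) b.1 : ℝ))) := by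
  have hγpos : 0 < γK := by rw [hγK]; exact gammaK_pos R hγ₀
  have hcK0 : 0 ≤ cK := by rw [hcK]; positivity
  have hprofF : ∀ s : ℝ, 0 < s → 0 ≤ (d : ℝ) * (R : ℝ) ^ d * Kf s := fun s hs => by have := hKf0 s hs; positivity
  have hprofU : ∀ s : ℝ, 0 < s → 0 ≤ (d : ℝ) * Kf s := fun s hs => by have := hKf0 s hs; positivity
  have hrF0 : 0 < rF := by rw [hrF]; exact rate_pos hprofF hγpos hcK0 hδH
  have hc₀0 : 0 ≤ c₀ := by rw [hc₀]; positivity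
  have hc₁0 : 0 ≤ c₁ := by rw [hc₁]; positivity
  have hΛ0 : 0 ≤ Λ := by rw [hΛ]; positivity
  have hK := coercive_reg_QB N R M hH hpsd hh hHub hγ₀ hker ha
  rw [← hγK] at hK
  have hUB := ub_QB N R M (H := H) hHub
  simp_rw [← hΛ] at hUB
  have hP := abs_blockProp_le_QB N R M hKf0 hKf hH hpsd hh hHub hγ₀ hker ha hh₀ hδH hHent hγK hcK hrF hc₀
  have hKQ := abs_inv_mul_transpose_le_QB N R M hKf0 hKf hH hpsd hh hHub hγ₀ hker ha hh₀ hδH hHent hγK hcK hrF hc₁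
  have h := abs_minOp_le hprofU (isPseudoDist_coarse N M) (sumBound_coarse N M hKf) hH hpsd ha hγpos hK hΛ0 hUB hc₀0 hrF0 hP
    (σ := fun (x : Tor (fine (R * N) M) × Fin d) (b : Tor (fine N M) × Fin d) => (tdist (par N R M x.1) b.1 : ℝ))
    (fun x b => Nat.cast_nonneg _) (fun x b b' => by exact_mod_cast tdist_triangle (par N R M x.1) b'.1 b.1) hc₁0 hrF0 hKQ x b
  rw [← hrU, ← hm] at h
  exact h

/-- **`abs_flucCov_le_QB` — THE FLUCTUATION COVARIANCE OF BAŁABAN's ONE-STEP CONSTRAINT IS LOCALISED IN THE BLOCK DISTANCE** [our proof; PART 106 `abs_flucCov_le` with the letters of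
`abs_minOp_le_QB`, `D ≤ σ + σ` (torus triangle inequality), `Kσ = d·Kf` (`sum_exp_sigma_le`) and the soft letter `abs_inv_regForm_le` (`C = 2∕γ_K`, `δ = r_F`)]:
`|𝒢(x,x′)| ≤ (2∕γ_K + 2(Λ+a)·c₁²·(d·Kf(m∕2))·(d·Kf(m∕4)))·e^{−min r_F (m∕4)·tdist(par x, par x′)}`, `m = min r_F r_U`. -/
theorem abs_flucCov_le_QB (hKf0 : ∀ s : ℝ, 0 < s → 0 ≤ Kf s)
    (hKf : ∀ s : ℝ, 0 < s → ∀ y : Tor (fine N M), ∑ y' : Tor (fine N M), Real.exp (-(s * (tdist y y' : ℝ))) ≤ Kf s)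
    (hH : Hᵀ = H) (hpsd : ∀ z, 0 ≤ z ⬝ᵥ (H *ᵥ z)) {h : ℝ} (hh : 0 ≤ h) (hHub : ∀ u, u ⬝ᵥ (H *ᵥ u) ≤ h * (u ⬝ᵥ u)) {γ₀ : ℝ} (hγ₀ : 0 < γ₀)
    (hker : ∀ z, reM (QB N R M) *ᵥ z = 0 → γ₀ * (z ⬝ᵥ z) ≤ z ⬝ᵥ (H *ᵥ z)) {a h₀ δH : ℝ} (ha : 0 < a) (hh₀ : 0 ≤ h₀) (hδH : 0 < δH)
    (hHent : ∀ x x', |H x x'| ≤ h₀ * Real.exp (-(δH * (tdist (par N R M x.1) (par N R M x'.1) : ℝ))))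
    {γK cK rF c₀ c₁ Λ rU m : ℝ} (hγK : γK = (max (4 / γ₀) ((4 * h * ((R : ℝ) ^ d) ^ 2 / γ₀ + 2 * ((R : ℝ) ^ d) ^ 2) / a))⁻¹)
    (hcK : cK = h₀ + a * (((R : ℝ) ^ d)⁻¹ * ((R : ℝ) ^ d)⁻¹) * Real.exp (2 * δH)) (hrF : rF = rate (fun s => (d : ℝ) * (R : ℝ) ^ d * Kf s) γK cK δH)
    (hc₀ : c₀ = 2 / γK * Real.exp (2 * rF)) (hc₁ : c₁ = 2 / γK * Real.exp rF) (hΛ : Λ = h * ((R : ℝ) ^ d) ^ 2)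
    (hrU : rU = rate (fun s => (d : ℝ) * Kf s) (Λ + a)⁻¹ c₀ rF) (hm : m = min rF rU)
    (x x' : Tor (fine (R * N) M) × Fin d) :
    |flucCov H (reM (QB N R M)) x x'| ≤ (2 / γK + 2 * (Λ + a) * c₁ ^ 2 * ((d : ℝ) * Kf (m / 2)) * ((d : ℝ) * Kf (m / 4))) *
      Real.exp (-(min rF (m / 4) * (tdist (par N R M x.1) (par N R M x'.1) : ℝ))) := by
  have hγpos : 0 < γK := by rw [hγK]; exact gammaK_pos R hγ₀
  have hcK0 : 0 ≤ cK := by rw [hcK]; positivity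
  have hprofF : ∀ s : ℝ, 0 < s → 0 ≤ (d : ℝ) * (R : ℝ) ^ d * Kf s := fun s hs => by have := hKf0 s hs; positivity
  have hprofU : ∀ s : ℝ, 0 < s → 0 ≤ (d : ℝ) * Kf s := fun s hs => by have := hKf0 s hs; positivity
  have hrF0 : 0 < rF := by rw [hrF]; exact rate_pos hprofF hγpos hcK0 hδH
  have hc₀0 : 0 ≤ c₀ := by rw [hc₀]; positivity
  have hc₁0 : 0 ≤ c₁ := by rw [hc₁]; positivity
  have hΛ0 : 0 ≤ Λ := by rw [hΛ]; positivity
  have hK := coercive_reg_QB N R M hH hpsd hh hHub hγ₀ hker ha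
  rw [← hγK] at hK
  have hUB := ub_QB N R M (H := H) hHub
  simp_rw [← hΛ] at hUB
  have hP := abs_blockProp_le_QB N R M hKf0 hKf hH hpsd hh hHub hγ₀ hker ha hh₀ hδH hHent hγK hcK hrF hc₀
  have hKQ := abs_inv_mul_transpose_le_QB N R M hKf0 hKf hH hpsd hh hHub hγ₀ hker ha hh₀ hδH hHent hγK hcK hrF hc₁
  have hG := abs_inv_regForm_le N R M hKf0 hKf hH hpsd hh hHub hγ₀ hker ha hh₀ hδH hHent hγK hcK hrF
  have h := abs_flucCov_le hprofU (isPseudoDist_coarse N M) (sumBound_coarse N M hKf) hH hpsd ha hγpos hK hΛ0 hUB hc₀0 hrF0 hP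
    (σ := fun (x : Tor (fine (R * N) M) × Fin d) (b : Tor (fine N M) × Fin d) => (tdist (par N R M x.1) b.1 : ℝ))
    (D := fun x x' : Tor (fine (R * N) M) × Fin d => (tdist (par N R M x.1) (par N R M x'.1) : ℝ))
    (Kσ := fun s => (d : ℝ) * Kf s)
    (fun x b => Nat.cast_nonneg _) (fun x b b' => by exact_mod_cast tdist_triangle (par N R M x.1) b'.1 b.1) hc₁0 hrF0 hKQ
    (fun x x' b => by
      have h1 := tdist_triangle (par N R M x.1) b.1 (par N R M x'.1)
      rw [tdist_comm b.1] at h1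
      exact_mod_cast h1)
    (fun s hs x => sum_exp_sigma_le N R M hKf hs x) (fun x x' => Nat.cast_nonneg _) (by positivity : (0 : ℝ) ≤ 2 / γK) hG x x'
  rw [← hrU, ← hm] at h
  exact h

end End

end Summit.QuantumFields.BalabanUV.Beta.GAN24.OneStepConstraintLocalisation

end
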